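import Summits.AtomisticToContinuum.HydrodynamicLimit.Theses.ImplosionDichotomy

/-!
# Route ImplosionDichotomy — `ProfilewiseOfInBand` (item stmt-AtomisticToContinuum-17373)

`ProfilewiseOfInBand := HydroLimitInBand → HydroLimitProfilewiseBand` is pure glue: the uniform
packing-guarded hydrodynamic limit (`∃ η₀ > 0, ∀ profiles, ∃ σ₀ > 0, …`, item stmt-9133 = the re-typed
Statement verbatim) implies the profile-wise one (`∀ profiles, ∃ η > 0, ∃ σ₀ > 0, …`, item stmt-17372):
for given profiles take `η := η₀`. It keeps the crux `HydroLimitInBand` inside the cone of the route's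
deciding theorem `closes (hD : DiluteSelfConsistency) (hP : HydroLimitProfilewiseBand)`.
-/

namespace Summit.AtomisticToContinuum.HydrodynamicLimit.Theorems

open Summit.AtomisticToContinuum.HydrodynamicLimit.Theses in
/-- Item stmt-AtomisticToContinuum-17373 of route ImplosionDichotomy:
`HydroLimitInBand → HydroLimitProfilewiseBand`. A uniform packing threshold `η₀` (valid for all
continuous positive profiles) is in particular a profile-wise threshold: given profiles `(a₀, u₀, θ₀)`,
take `η := η₀` and the `σ₀` that `HydroLimitInBand` provides for these profiles (∃∀ ⇒ ∀∃). -/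
theorem profilewiseOfInBand_proof :
    Summit.AtomisticToContinuum.HydrodynamicLimit.Theses.ImplosionDichotomy.ProfilewiseOfInBand := by
  unfold ImplosionDichotomy.ProfilewiseOfInBand
  intro hIn a₀ θ₀ u₀ ha hθ hu ha0 hθ0
  obtain ⟨η₀, hη₀, H⟩ := hIn
  exact ⟨η₀, hη₀, H a₀ θ₀ u₀ ha hθ hu ha0 hθ0⟩

end Summit.AtomisticToContinuum.HydrodynamicLimit.Theorems
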